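import Mathlib.RingTheory.RootsOfUnity.AlgebraicallyClosed
import Literature.NumberTheory.GaloisRepresentations.KummerLayerApprox
import Literature.NumberTheory.GaloisRepresentations.LocalGaloisSolvable
import Literature.NumberTheory.Automorphic.AdicCompletionLocalField
import Literature.FieldTheory.Galois.FixingSubgroupIndex
import HarnessLib

/-!
# One Hecke–Kummer round: a cyclic layer of prime degree with prescribed completion

Topic `NumberTheory/GaloisRepresentations`; theorems only (no definition, no named fact).  Let `K`
be a number field, `v₀` a finite place, `k ⊆ K̄` a finite Galois extension of `K`, `ι : K̄ → \bar K_{v₀}`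
the chosen embedding, `H = {σ ∈ Γ_{K_{v₀}} | σ fixes ι k}` (the absolute Galois group of the
completion `k_w`, `w | v₀` the place cut out by `ι`) and `N ≤ Γ_{K_{v₀}}` an open normal subgroup
with `H ⊄ N`.  `exists_layer` produces a Galois extension `M/k` of prime degree `ℓ` inside `K̄`
whose local group `{σ | σ fixes ι M}` is a normal subgroup `H' ≤ H` of index `ℓ` containing
`H ⊓ N` — so that `[H' : H' ⊓ N] · ℓ = [H : H ⊓ N]` strictly drops — together with the local data
at an auxiliary finite set `V` of places where `k` splits and at the real places that the next
file uses to show that all `Γ_K`-conjugates of `M` are again split at `V` and that `M` is totally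
real when `k` is.

The construction is Hecke's (Kummer theory after adjoining `ζ_ℓ`, `ω`-twisted norm, descent):
`ℓ` and `H'` come from a chief factor of `H / (H ⊓ N)` (`exists_le_normal_prime_relIndex_of_not_le`,
solvability of local Galois groups), the local Kummer generator `β` from `exists_kummer_generator`,
the radicand `a ∈ k(ζ)` from `exists_radicand` (approximation), the identity
`ι A = (β^d Y)^ℓ` for the twisted norm `A` from `exists_pow_mul_pow_eq_absClosureEmbedding_prod`,
the degree-`ℓ` subfield `M ⊆ k(ζ, A^{1/ℓ})` from `exists_isGalois_finrank_eq_prime_sup_eq`, and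
the identification of its local group with `H'` from `eq_of_relIndex_dvd_of_inf_eq`.

## References

* H. Cohen, *Advanced Topics in Computational Number Theory*, GTM 193, §10.2.3, Thm. 10.2.9;
  H. Cohen, P. Stevenhagen, *Computational class field theory*, MSRI Publ. 44 (2008), §5.
  [cite: BuhlerStevenhagen2008, §5 p. 532]
* J. Neukirch, *Algebraic Number Theory*, II §9 (9.6), IV §1, VI §1. [NeukirchANT1999]
-/

noncomputable section

open scoped NumberField IntermediateField Valued
open Field IsDedekindDomain IntermediateField
open Literature.FieldTheory.Kummer Literature.FieldTheory.Galois

universe u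

namespace Literature.NumberTheory.GaloisRepresentations

variable (K : Type u) [Field K] [NumberField K]

/-! ### Helpers -/

omit [NumberField K] in
/-- Fixedness under `σ ∘ f` passes from `k` and a generating set to `k(S)`. [folklore] -/
theorem forall_mem_adjoin_smul_eq {Ω : Type*} [Field Ω] {G : Type*} [Group G]
    [MulSemiringAction G Ω] (k : IntermediateField K (AlgebraicClosure K))
    (S : Set (AlgebraicClosure K)) (f : AlgebraicClosure K →+* Ω) (σ : G)
    (hk : ∀ x ∈ k, σ • f x = f x) (hS : ∀ x ∈ S, σ • f x = f x) :
    ∀ x ∈ IntermediateField.adjoin (↥k) S, σ • f x = f x := by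
  intro x hx
  induction hx using IntermediateField.adjoin_induction with
  | mem y hy => exact hS y hy
  | algebraMap c => exact hk c c.2
  | add x y _ _ hx hy => rw [map_add, smul_add, hx, hy]
  | inv x _ hx => rw [map_inv₀, smul_inv'', hx]
  | mul x y _ _ hx hy => rw [map_mul, smul_mul', hx, hy]

/-- The local group `{σ | σ fixes ι k}` of a finite extension `k` is open in `Γ_{K_v}`.
[folklore] -/
theorem isOpen_of_forall_mem_iff (v : HeightOneSpectrum (𝓞 K))
    (k : IntermediateField K (AlgebraicClosure K)) [FiniteDimensional K k]
    {H : Subgroup (absoluteGaloisGroup (v.adicCompletion K))}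
    (hH : ∀ σ, σ ∈ H ↔ ∀ x ∈ k, σ • absClosureEmbedding K (v.adicCompletion K) x =
      absClosureEmbedding K (v.adicCompletion K) x) :
    IsOpen (H : Set (absoluteGaloisGroup (v.adicCompletion K))) := by
  have h1 : IsOpen ((k.fixingSubgroup.comap (absoluteGaloisGroup.toAlgEquiv K).toMonoidHom :
      Subgroup (absoluteGaloisGroup K)) : Set (absoluteGaloisGroup K)) :=
    IntermediateField.fixingSubgroup_isOpen k
  have h2 := h1.preimage (absGaloisRestrict K (v.adicCompletion K)).continuous_toFun
  convert h2 using 1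
  ext σ
  rw [SetLike.mem_coe, hH, Set.mem_preimage, SetLike.mem_coe, Subgroup.mem_comap,
    MulEquiv.coe_toMonoidHom, forall_smul_absClosureEmbedding_eq_iff]
  exact (absGaloisRestrict_mem_fixingSubgroup_iff K v k σ).symm

/-- `k(ζ)` is normal over `K` when `k` is and `ζ` is a root of unity. [folklore] -/
theorem normal_restrictScalars_adjoin_of_isPrimitiveRoot
    (k : IntermediateField K (AlgebraicClosure K)) [Normal K k] {ℓ : ℕ} (hℓ : ℓ.Prime)
    {ζg : AlgebraicClosure K} (hζg : IsPrimitiveRoot ζg ℓ) :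
    Normal K (IntermediateField.restrictScalars K (↥k)⟮ζg⟯) := by
  rw [IntermediateField.normal_iff_forall_map_le']
  intro τ x hx
  obtain ⟨y, hy, rfl⟩ := hx
  change y ∈ (↥k)⟮ζg⟯ at hy
  change (τ : AlgebraicClosure K →ₐ[K] AlgebraicClosure K) y ∈ (↥k)⟮ζg⟯
  induction hy using IntermediateField.adjoin_induction with
  | mem z hz =>
      rw [Set.mem_singleton_iff] at hz
      subst hz
      obtain ⟨n, hn⟩ := exists_smul_eq_pow K hℓ hζg ((absoluteGaloisGroup.toAlgEquiv K).symm τ)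
      have h1 : (τ : AlgebraicClosure K →ₐ[K] AlgebraicClosure K) z = z ^ n := hn
      rw [h1]
      exact pow_mem (mem_adjoin_simple_self _ z) n
  | algebraMap c =>
      have h1 : (τ : AlgebraicClosure K →ₐ[K] AlgebraicClosure K) (algebraMap (↥k) _ c) ∈ k :=
        smul_mem_of_normal k ((absoluteGaloisGroup.toAlgEquiv K).symm τ) c.2
      exact IntermediateField.algebraMap_mem (↥k)⟮ζg⟯ (⟨_, h1⟩ : k)
  | add x y _ _ hx hy => rw [map_add]; exact add_mem hx hy
  | inv x _ hx => rw [map_inv₀]; exact inv_mem hx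
  | mul x y _ _ hx hy => rw [map_mul]; exact mul_mem hx hy

/-- `Gal(K̄/M)` is normalised by `Gal(K̄/k)` for `M/k` normal. [folklore] -/
theorem conj_mem_fixingSubgroup_of_normal (k : IntermediateField K (AlgebraicClosure K))
    (M : IntermediateField (↥k) (AlgebraicClosure K)) [Normal (↥k) M]
    {a b : AlgebraicClosure K ≃ₐ[K] AlgebraicClosure K} (ha : a ∈ k.fixingSubgroup)
    (hb : b ∈ (M.restrictScalars K).fixingSubgroup) :
    a * b * a⁻¹ ∈ (M.restrictScalars K).fixingSubgroup := by
  rw [mem_fixingSubgroup_restrictScalars_iff] at hb ⊢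
  intro x hx
  -- `a⁻¹ x ∈ M` by normality of `M/k`
  set a' : AlgebraicClosure K ≃ₐ[↥k] AlgebraicClosure K :=
    IntermediateField.fixingSubgroupEquiv k ⟨a⁻¹, inv_mem ha⟩ with ha'
  have h1 : a⁻¹ x ∈ M := by
    have h := (IntermediateField.normal_iff_forall_map_le'.1 (inferInstance : Normal (↥k) M)) a'
    exact h ⟨x, hx, rfl⟩
  rw [AlgEquiv.mul_apply, AlgEquiv.mul_apply, hb _ h1, ← AlgEquiv.mul_apply, mul_inv_cancel,
    AlgEquiv.one_apply]

/-- Index bookkeeping: `H ⊓ N ≤ H' ≤ H`, `[H : H'] = ℓ` give `[H' : H' ⊓ N] · ℓ = [H : H ⊓ N]`.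
[folklore] -/
theorem relIndex_mul_eq_of_inf_le {G : Type*} [Group G] {N H H' : Subgroup G} (hHN : H ⊓ N ≤ H')
    (hle : H' ≤ H) {ℓ : ℕ} (hidx : H'.relIndex H = ℓ) : N.relIndex H' * ℓ = N.relIndex H := by
  have key : ∀ L : Subgroup G, L ≤ H → N.relIndex L = (H ⊓ N).relIndex L := by
    intro L hL
    rw [← Subgroup.inf_relIndex_right N, ← Subgroup.inf_relIndex_right (H ⊓ N)]
    congr 1
    ext x
    constructor
    · rintro ⟨hxN, hxL⟩
      exact ⟨⟨hL hxL, hxN⟩, hxL⟩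
    · rintro ⟨⟨-, hxN⟩, hxL⟩
      exact ⟨hxN, hxL⟩
  rw [key H' hle, key H le_rfl, ← hidx]
  exact Subgroup.relIndex_mul_relIndex (H ⊓ N) H' H hHN hle

/-! ### The round -/

set_option maxHeartbeats 800000 in
/-- **One Hecke–Kummer round.**  See the module docstring.  Output: the prime `ℓ`, a primitive
`ℓ`-th root of unity `ζ ∈ K̄`, a radical `α` (`α ^ ℓ = A ∈ k(ζ)`, the twisted norm), and the layer
`M` with: `M ⊆ k(ζ, α)`, `k(ζ) M = k(ζ, α)`, `M/k` Galois of degree `ℓ`; the local group of `M` at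
`ι` is a subgroup `H' ≤ H` with `[H' : H' ⊓ N] · ℓ = [H : H ⊓ N] ≠ 0`; at each `u ∈ V`,
`ι_u (γ α) ^ ℓ` is the `ℓ`-th power of an element fixed by the stabiliser of `ι_u ζ` (all
`γ ∈ Γ_K`); and `ρ A > 0` at every real embedding `ρ` of `k(ζ)`.
Cohen–Stevenhagen §5; Cohen, *Advanced Topics*, Thm. 10.2.9; Neukirch VI §1.
[cite: BuhlerStevenhagen2008, §5 p. 532] -/
theorem exists_layer (v₀ : HeightOneSpectrum (𝓞 K))
    (k : IntermediateField K (AlgebraicClosure K)) [FiniteDimensional K k] [IsGalois K k]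
    (N : Subgroup (absoluteGaloisGroup (v₀.adicCompletion K))) [N.Normal]
    (hN : IsOpen (N : Set (absoluteGaloisGroup (v₀.adicCompletion K))))
    {H : Subgroup (absoluteGaloisGroup (v₀.adicCompletion K))}
    (hH : ∀ σ, σ ∈ H ↔ ∀ x ∈ k, σ • absClosureEmbedding K (v₀.adicCompletion K) x =
      absClosureEmbedding K (v₀.adicCompletion K) x)
    (hnot : ¬ H ≤ N) (V : Finset (HeightOneSpectrum (𝓞 K))) (hV : v₀ ∉ V)
    (hsplit : ∀ u ∈ V, ∀ (σ : absoluteGaloisGroup (u.adicCompletion K)), ∀ x ∈ k,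
      σ • absClosureEmbedding K (u.adicCompletion K) x = absClosureEmbedding K (u.adicCompletion K) x) :
    ∃ (ℓ : ℕ) (ζg α : AlgebraicClosure K) (M : IntermediateField (↥k) (AlgebraicClosure K)),
      ℓ.Prime ∧ IsPrimitiveRoot ζg ℓ ∧ M ≤ (↥k)⟮ζg, α⟯ ∧ (↥k)⟮ζg⟯ ⊔ M = (↥k)⟮ζg, α⟯ ∧
      FiniteDimensional (↥k) M ∧ IsGalois (↥k) M ∧ Module.finrank (↥k) M = ℓ ∧
      (∃ H' : Subgroup (absoluteGaloisGroup (v₀.adicCompletion K)), H' ≤ H ∧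
        (∀ σ, (∀ x : AlgebraicClosure K, x ∈ M →
          σ • absClosureEmbedding K (v₀.adicCompletion K) x =
            absClosureEmbedding K (v₀.adicCompletion K) x) ↔ σ ∈ H') ∧
        N.relIndex H' * ℓ = N.relIndex H ∧ N.relIndex H ≠ 0) ∧
      (∀ u ∈ V, ∀ γ : absoluteGaloisGroup K, ∃ z : AlgebraicClosure (u.adicCompletion K),
        (∀ σ : absoluteGaloisGroup (u.adicCompletion K),
          σ • absClosureEmbedding K (u.adicCompletion K) ζg =
            absClosureEmbedding K (u.adicCompletion K) ζg → σ • z = z) ∧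
        absClosureEmbedding K (u.adicCompletion K) (γ • α) ^ ℓ = z ^ ℓ) ∧
      (∃ hA : α ^ ℓ ∈ (↥k)⟮ζg⟯, ∀ ρ : (↥k)⟮ζg⟯ →+* ℝ, 0 < ρ ⟨α ^ ℓ, hA⟩) := by
  classical
  haveI : CharZero (v₀.adicCompletion K) :=
    charZero_of_injective_algebraMap (algebraMap K _).injective
  -- R1–R2: the chief factor
  have hHopen : IsOpen (H : Set (absoluteGaloisGroup (v₀.adicCompletion K))) :=
    isOpen_of_forall_mem_iff K v₀ k hH
  obtain ⟨H', hHN, hle, hH'n, hprime⟩ :=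
    exists_le_normal_prime_relIndex_of_not_le (v₀.adicCompletion K) N hN H hnot
  set ℓ : ℕ := H'.relIndex H with hℓdef
  have hℓ : ℓ.Prime := hprime
  haveI : NeZero ℓ := ⟨hℓ.ne_zero⟩
  have hnorm : ∀ h ∈ H, ∀ h' ∈ H', h * h' * h⁻¹ ∈ H' := fun h hh h' hh' =>
    (Subgroup.normal_subgroupOf_iff hle).1 hH'n h' h hh' hh
  have hidx : H'.relIndex H = ℓ := rfl
  have hH'open : IsOpen (H' : Set (absoluteGaloisGroup (v₀.adicCompletion K))) :=
    Subgroup.isOpen_mono hHN (hHopen.inter hN)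
  -- R3: a primitive `ℓ`-th root of unity and its stabiliser
  haveI : NeZero ((ℓ : ℕ) : K) := ⟨Nat.cast_ne_zero.2 hℓ.ne_zero⟩
  obtain ⟨ζg, hζg⟩ := HasEnoughRootsOfUnity.exists_primitiveRoot (AlgebraicClosure K) ℓ
  set Z : Subgroup (absoluteGaloisGroup (v₀.adicCompletion K)) :=
    MulAction.stabilizer (absoluteGaloisGroup (v₀.adicCompletion K))
      (absClosureEmbedding K (v₀.adicCompletion K) ζg) with hZdef
  have hZ : ∀ σ, σ ∈ Z ↔ σ • absClosureEmbedding K (v₀.adicCompletion K) ζg =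
      absClosureEmbedding K (v₀.adicCompletion K) ζg := fun σ => MulAction.mem_stabilizer_iff
  have hζ : IsPrimitiveRoot (absClosureEmbedding K (v₀.adicCompletion K) ζg) ℓ :=
    hζg.map_of_injective (absClosureEmbedding K (v₀.adicCompletion K)).injective
  -- R5: `s` and the separation witnesses
  obtain ⟨s, hs, hs'⟩ := exists_mem_inf_not_mem (v₀.adicCompletion K) hℓ hζ hZ hle hnorm hidx
  have hW'W : H' ⊓ Z ≤ H ⊓ Z := inf_le_inf_right Z hle
  have hζW : ∀ w ∈ H ⊓ Z, w • absClosureEmbedding K (v₀.adicCompletion K) ζg =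
      absClosureEmbedding K (v₀.adicCompletion K) ζg := fun w hw => (hZ w).1 hw.2
  have hnormW : ∀ w ∈ H ⊓ Z, ∀ w' ∈ H' ⊓ Z, w * w' * w⁻¹ ∈ H' ⊓ Z := fun w hw w' hw' =>
    conj_mem_inf_of_mem_inf (v₀.adicCompletion K) hℓ hζ hZ hnorm hw hw'
  have hidxW := (relIndex_inf_eq_of_prime (v₀.adicCompletion K) hℓ hζ hZ hle hnorm hidx).1
  have hsep : ∀ i, 0 < i → i < ℓ → ∃ θ : AlgebraicClosure (v₀.adicCompletion K),
      (∀ w ∈ H' ⊓ Z, w • θ = θ) ∧ (s ^ i) • θ ≠ θ := fun i hi0 hi =>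
    exists_fixed_pow_smul_ne (v₀.adicCompletion K) hℓ hζ hZ hle hnorm hidx hH'open hs hs' hi0 hi
  -- R6: the local Kummer generator
  obtain ⟨β, hβ0, hβW', hsβ⟩ := exists_kummer_generator (K₀ := v₀.adicCompletion K)
    (Ω := AlgebraicClosure (v₀.adicCompletion K)) hℓ hζ
    (W := (H ⊓ Z : Subgroup (AlgebraicClosure (v₀.adicCompletion K) ≃ₐ[v₀.adicCompletion K]
      AlgebraicClosure (v₀.adicCompletion K))))
    (W' := (H' ⊓ Z : Subgroup (AlgebraicClosure (v₀.adicCompletion K) ≃ₐ[v₀.adicCompletion K]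
      AlgebraicClosure (v₀.adicCompletion K)))) hW'W hnormW hidxW
    (s := absoluteGaloisGroup.toAlgEquiv (v₀.adicCompletion K) s) hs hζW hsep
  have hβW'' : ∀ w ∈ H' ⊓ Z, w • β = β := hβW'
  have hsβ' : s • β = absClosureEmbedding K (v₀.adicCompletion K) ζg * β := hsβ
  -- R7: the global field `k(ζ)`
  haveI : FiniteDimensional (↥k) (↥k)⟮ζg⟯ :=
    IntermediateField.adjoin.finiteDimensional
      ((Algebra.IsIntegral.isIntegral (R := K) ζg).tower_top)
  have hnormal : Normal K (IntermediateField.restrictScalars K (↥k)⟮ζg⟯) :=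
    normal_restrictScalars_adjoin_of_isPrimitiveRoot K k hℓ hζg
  haveI hnk : Normal (↥k) (AlgebraicClosure K) :=
    Normal.tower_top_of_normal K (↥k) (AlgebraicClosure K)
  have hWE : ∀ w ∈ H ⊓ Z, ∀ x ∈ (↥k)⟮ζg⟯, w • absClosureEmbedding K (v₀.adicCompletion K) x =
      absClosureEmbedding K (v₀.adicCompletion K) x := fun w hw =>
    (mem_inf_iff_forall_smul_eq K v₀ k hZ hH w).1 hw
  -- R8: the twisting exponents
  obtain ⟨m, hm⟩ := exists_mul_modEq_one (k := ↥k) (Ω := AlgebraicClosure K) hℓ hζg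
  -- R9: the radicand
  obtain ⟨⟨a, ha⟩, ha0, hC1, hC2, hC3, hC4⟩ := exists_radicand K v₀ k hℓ hζg hnormal hZ hH hle
    hnorm hidx hs hs' hβ0 hβW'' hsβ' V hV hsplit
  change a ≠ 0 at ha0
  -- R10: the twisted norm, its `ℓ`-th root, the class identity, the descent
  obtain ⟨d, Y, hd0, hdℓ, hY0, hYW, hAY⟩ := exists_pow_mul_pow_eq_absClosureEmbedding_prod K v₀
    k hℓ hζg hnormal ha ha0 m hm hZ hH hle hnorm hidx hs hs' hβ0 hβW'' hsβ' hC1 hC2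
  set A : AlgebraicClosure K :=
    ∏ σ : (↥k)⟮ζg⟯ ≃ₐ[↥k] (↥k)⟮ζg⟯, ((σ ⟨a, ha⟩ : (↥k)⟮ζg⟯) : AlgebraicClosure K) ^ m σ with hA
  have hA_mem : A ∈ (↥k)⟮ζg⟯ := prod_mem fun σ _ => pow_mem (σ ⟨a, ha⟩).2 _
  have hσa0 : ∀ σ : (↥k)⟮ζg⟯ ≃ₐ[↥k] (↥k)⟮ζg⟯, ((σ ⟨a, ha⟩ : (↥k)⟮ζg⟯) : AlgebraicClosure K) ≠ 0 :=
    fun σ => by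
      rw [Ne, ZeroMemClass.coe_eq_zero, map_eq_zero]
      exact fun h0 => ha0 (congrArg Subtype.val h0)
  have hA0 : A ≠ 0 := Finset.prod_ne_zero_iff.2 fun σ _ => pow_ne_zero _ (hσa0 σ)
  obtain ⟨α, hα⟩ := IsAlgClosed.exists_pow_nat_eq A hℓ.pos
  have hd : ¬ ℓ ∣ d := fun h => not_lt.2 (Nat.le_of_dvd hd0 h) hdℓ
  have hnot' : ∀ b' ∈ (↥k)⟮ζg⟯, b' ^ ℓ ≠ A := by
    intro b' hb' h
    have h1 : (absClosureEmbedding K (v₀.adicCompletion K) b') ^ ℓ = (β ^ d * Y) ^ ℓ := by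
      rw [← map_pow, h, hA, hAY]
    exact pow_ne_of_kummer (K₀ := v₀.adicCompletion K)
      (Ω := AlgebraicClosure (v₀.adicCompletion K)) hℓ hζ
      (W := (H ⊓ Z : Subgroup (AlgebraicClosure (v₀.adicCompletion K) ≃ₐ[v₀.adicCompletion K]
        AlgebraicClosure (v₀.adicCompletion K))))
      (W' := (H' ⊓ Z : Subgroup (AlgebraicClosure (v₀.adicCompletion K) ≃ₐ[v₀.adicCompletion K]
        AlgebraicClosure (v₀.adicCompletion K)))) hW'W hnormW hidxW
      (s := absoluteGaloisGroup.toAlgEquiv (v₀.adicCompletion K) s) hs hs' hζW hβ0 hβW' hsβ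
      hd hY0 hYW (fun w hw => hWE w hw b' hb') h1
  have hE : ∀ τ : AlgebraicClosure K ≃ₐ[↥k] AlgebraicClosure K, ∀ n : ℕ, τ ζg = ζg ^ n →
      ∃ c ∈ (↥k)⟮ζg⟯, τ A = A ^ n * c ^ ℓ := fun τ n hτ => by
    rw [hA]; exact eigen_of_prod_pow hℓ hζg ha ha0 m hm τ n hτ
  obtain ⟨M, hMle, hMgal, hMrank, hMsup⟩ :=
    exists_isGalois_finrank_eq_prime_sup_eq (k := ↥k) (Ω := AlgebraicClosure K) hℓ hζg hA_mem
      hA0 hα hE hnot'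
  haveI := hMgal
  haveI hMfin : FiniteDimensional (↥k) M :=
    Module.finite_of_finrank_pos (by rw [hMrank]; exact hℓ.pos)
  -- R11: the local group of `M`
  set X : Subgroup (absoluteGaloisGroup (v₀.adicCompletion K)) :=
    ((M.restrictScalars K).fixingSubgroup.comap
      (absoluteGaloisGroup.toAlgEquiv K).toMonoidHom).comap
      (absGaloisRestrict K (v₀.adicCompletion K)).toMonoidHom with hXdef
  have hXmem : ∀ σ, σ ∈ X ↔ ∀ x : AlgebraicClosure K, x ∈ M →
      σ • absClosureEmbedding K (v₀.adicCompletion K) x =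
        absClosureEmbedding K (v₀.adicCompletion K) x := by
    intro σ
    rw [hXdef, Subgroup.mem_comap, Subgroup.mem_comap]
    change absoluteGaloisGroup.toAlgEquiv K (absGaloisRestrict K (v₀.adicCompletion K) σ) ∈
      (M.restrictScalars K).fixingSubgroup ↔ _
    rw [absGaloisRestrict_mem_fixingSubgroup_iff, ← forall_smul_absClosureEmbedding_eq_iff]
    rfl
  have hXH : X ≤ H := fun σ hσ => (hH σ).2 fun x hx =>
    (hXmem σ).1 hσ x (IntermediateField.algebraMap_mem M (⟨x, hx⟩ : k))
  -- `[H : X] ∣ ℓ`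
  have hdvd : X.relIndex H ∣ ℓ := by
    set f : absoluteGaloisGroup (v₀.adicCompletion K) →*
        (AlgebraicClosure K ≃ₐ[K] AlgebraicClosure K) :=
      (absoluteGaloisGroup.toAlgEquiv K).toMonoidHom.comp
        (absGaloisRestrict K (v₀.adicCompletion K)).toMonoidHom with hf
    have hHc : H = k.fixingSubgroup.comap f := by
      ext σ
      rw [hH, Subgroup.mem_comap, forall_smul_absClosureEmbedding_eq_iff]
      exact (absGaloisRestrict_mem_fixingSubgroup_iff K v₀ k σ).symm
    have hXc : X = (M.restrictScalars K).fixingSubgroup.comap f := by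
      rw [hXdef, Subgroup.comap_comap]
    rw [hHc, hXc, ← hMrank, ← relIndex_fixingSubgroup_restrictScalars_eq_finrank k M]
    refine relIndex_comap_dvd f (fun τ hτ => ?_) (fun a' ha' b' hb' =>
      conj_mem_fixingSubgroup_of_normal K k M ha' hb')
    rw [IntermediateField.mem_fixingSubgroup_iff] at hτ ⊢
    exact fun x hx => hτ x (IntermediateField.algebraMap_mem M (⟨x, hx⟩ : k))
  -- `X ⊓ W = W'`
  have hια : (absClosureEmbedding K (v₀.adicCompletion K) α) ^ ℓ = (β ^ d * Y) ^ ℓ := by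
    rw [← map_pow, hα, hA, hAY]
  have hXW : X ⊓ (H ⊓ Z) = H' ⊓ Z := by
    ext σ
    constructor
    · rintro ⟨hσX, hσW⟩
      have hfixα : σ • absClosureEmbedding K (v₀.adicCompletion K) α =
          absClosureEmbedding K (v₀.adicCompletion K) α := by
        -- `α ∈ k(ζ, α) = k(ζ) ⊔ M = adjoin k (k(ζ) ∪ M)`
        have hαmem : α ∈ (↥k)⟮ζg⟯ ⊔ M := by
          rw [hMsup]
          exact IntermediateField.subset_adjoin _ _ (Set.mem_insert_of_mem _ (Set.mem_singleton α))
        rw [← (IntermediateField.gi (F := ↥k) (E := AlgebraicClosure K)).l_sup_u] at hαmem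
        exact forall_mem_adjoin_smul_eq K k _
          ((absClosureEmbedding K (v₀.adicCompletion K) : AlgebraicClosure K →+*
            AlgebraicClosure (v₀.adicCompletion K))) σ (fun y hy => (hH σ).1 hσW.1 y hy)
          (fun y hy => by
            rcases hy with hy | hy
            · exact hWE σ hσW y hy
            · exact (hXmem σ).1 hσX y hy) α hαmem
      have hw : absoluteGaloisGroup.toAlgEquiv (v₀.adicCompletion K) σ ∈
          (H ⊓ Z : Subgroup (AlgebraicClosure (v₀.adicCompletion K) ≃ₐ[v₀.adicCompletion K]
            AlgebraicClosure (v₀.adicCompletion K))) := hσW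
      have h1 := (apply_eq_iff_apply_eq_of_pow_eq (K₀ := v₀.adicCompletion K)
        (Ω := AlgebraicClosure (v₀.adicCompletion K)) hℓ hζ
        (W := (H ⊓ Z : Subgroup (AlgebraicClosure (v₀.adicCompletion K) ≃ₐ[v₀.adicCompletion K]
          AlgebraicClosure (v₀.adicCompletion K))))
        (W' := (H' ⊓ Z : Subgroup (AlgebraicClosure (v₀.adicCompletion K) ≃ₐ[v₀.adicCompletion K]
          AlgebraicClosure (v₀.adicCompletion K)))) hW'W hnormW hidxW
        (s := absoluteGaloisGroup.toAlgEquiv (v₀.adicCompletion K) s) hs hs' hζW hβ0 hβW' hsβ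
        hd hY0 hYW hια hw).1 hfixα
      exact (apply_eq_iff_mem_of_kummer (K₀ := v₀.adicCompletion K)
        (Ω := AlgebraicClosure (v₀.adicCompletion K)) hℓ hζ
        (W := (H ⊓ Z : Subgroup (AlgebraicClosure (v₀.adicCompletion K) ≃ₐ[v₀.adicCompletion K]
          AlgebraicClosure (v₀.adicCompletion K))))
        (W' := (H' ⊓ Z : Subgroup (AlgebraicClosure (v₀.adicCompletion K) ≃ₐ[v₀.adicCompletion K]
          AlgebraicClosure (v₀.adicCompletion K)))) hW'W hnormW hidxW
        (s := absoluteGaloisGroup.toAlgEquiv (v₀.adicCompletion K) s) hs hs' hζW hβ0 hβW' hsβ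
        hw).1 h1
    · intro hσ
      have hσW : σ ∈ H ⊓ Z := hW'W hσ
      have hfixβ : σ • β = β := hβW'' σ hσ
      have hfixα : σ • absClosureEmbedding K (v₀.adicCompletion K) α =
          absClosureEmbedding K (v₀.adicCompletion K) α :=
        (apply_eq_iff_apply_eq_of_pow_eq (K₀ := v₀.adicCompletion K)
          (Ω := AlgebraicClosure (v₀.adicCompletion K)) hℓ hζ
          (W := (H ⊓ Z : Subgroup (AlgebraicClosure (v₀.adicCompletion K) ≃ₐ[v₀.adicCompletion K]
            AlgebraicClosure (v₀.adicCompletion K))))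
          (W' := (H' ⊓ Z : Subgroup (AlgebraicClosure (v₀.adicCompletion K) ≃ₐ[v₀.adicCompletion K]
            AlgebraicClosure (v₀.adicCompletion K)))) hW'W hnormW hidxW
          (s := absoluteGaloisGroup.toAlgEquiv (v₀.adicCompletion K) s) hs hs' hζW hβ0 hβW' hsβ
          hd hY0 hYW hια (w := absoluteGaloisGroup.toAlgEquiv (v₀.adicCompletion K) σ) hσW).2
          hfixβ
      refine ⟨(hXmem σ).2 fun x hx => ?_, hσW⟩
      have hx' : x ∈ (↥k)⟮ζg, α⟯ := hMle hx
      exact forall_mem_adjoin_smul_eq K k {ζg, α}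
        ((absClosureEmbedding K (v₀.adicCompletion K) : AlgebraicClosure K →+*
          AlgebraicClosure (v₀.adicCompletion K))) σ
        (fun y hy => (hH σ).1 hσW.1 y hy)
        (fun y hy => by
          rcases hy with rfl | rfl
          · exact hζW σ hσW
          · exact hfixα) x hx'
  have hXeq : X = H' :=
    eq_of_relIndex_dvd_of_inf_eq (v₀.adicCompletion K) hℓ hζ hZ hle hnorm hidx hXH hdvd hXW
  -- the measure
  have hmeas : N.relIndex H' * ℓ = N.relIndex H := relIndex_mul_eq_of_inf_le hHN hle hidx
  have hfin : N.relIndex H ≠ 0 := by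
    haveI := finite_quotient_of_isOpen (v₀.adicCompletion K) N hN
    exact fun h0 => Subgroup.index_ne_zero_of_finite (Subgroup.index_eq_zero_of_relIndex_eq_zero h0)
  -- lifts of `Gal(k(ζ)/k)` to `Γ_K`
  have hlift : ∀ σ : (↥k)⟮ζg⟯ ≃ₐ[↥k] (↥k)⟮ζg⟯, ∃ γ : absoluteGaloisGroup K,
      ∀ y : (↥k)⟮ζg⟯, γ • (y : AlgebraicClosure K) = (σ y : AlgebraicClosure K) := by
    intro σ
    refine ⟨(absoluteGaloisGroup.toAlgEquiv K).symm
      ((σ.liftNormal (AlgebraicClosure K)).restrictScalars K), fun y => ?_⟩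
    change (σ.liftNormal (AlgebraicClosure K)) (y : AlgebraicClosure K) =
      (σ y : AlgebraicClosure K)
    exact σ.liftNormal_commutes (AlgebraicClosure K) y
  choose γσ hγσ using hlift
  refine ⟨ℓ, ζg, α, M, hℓ, hζg, hMle, hMsup, hMfin, hMgal, hMrank,
    ⟨H', hle, fun σ => by rw [← hXeq]; exact (hXmem σ).symm, hmeas, hfin⟩, ?_, ⟨hα.symm ▸ hA_mem, ?_⟩⟩
  · -- (C3) for `A`
    intro u hu γ
    have h1 : ∀ σ : (↥k)⟮ζg⟯ ≃ₐ[↥k] (↥k)⟮ζg⟯, ∃ z : AlgebraicClosure (u.adicCompletion K),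
        (∀ τ : absoluteGaloisGroup (u.adicCompletion K),
          τ • absClosureEmbedding K (u.adicCompletion K) ζg =
            absClosureEmbedding K (u.adicCompletion K) ζg → τ • z = z) ∧
        absClosureEmbedding K (u.adicCompletion K)
          (γ • ((σ ⟨a, ha⟩ : (↥k)⟮ζg⟯) : AlgebraicClosure K)) = z ^ ℓ := by
      intro σ
      obtain ⟨z, hz, hz'⟩ := hC3 u hu (γ * γσ σ)
      refine ⟨z, hz, ?_⟩
      rw [← hz', mul_smul, hγσ]
    choose z hz hz' using h1
    refine ⟨∏ σ, z σ ^ m σ, fun τ hτ => ?_, ?_⟩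
    · rw [Finset.smul_prod']
      exact Finset.prod_congr rfl fun σ _ => by rw [smul_pow', hz σ τ hτ]
    · rw [← map_pow, ← smul_pow', hα, hA, Finset.smul_prod', map_prod]
      simp_rw [smul_pow', map_pow, hz']
      rw [← Finset.prod_pow]
      exact Finset.prod_congr rfl fun σ _ => by rw [← pow_mul, mul_comm, pow_mul]
  · -- (C4) for `A`
    intro ρ
    have h1 : (⟨α ^ ℓ, hα.symm ▸ hA_mem⟩ : (↥k)⟮ζg⟯) = ∏ σ : (↥k)⟮ζg⟯ ≃ₐ[↥k] (↥k)⟮ζg⟯,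
        (σ ⟨a, ha⟩) ^ m σ := by
      apply Subtype.ext
      rw [IntermediateField.coe_prod]
      simp only [SubmonoidClass.coe_pow, hα, hA]
    rw [h1, map_prod]
    exact Finset.prod_pos fun σ _ => by
      rw [map_pow]
      exact pow_pos (hC4 (ρ.comp (σ : (↥k)⟮ζg⟯ ≃ₐ[↥k] (↥k)⟮ζg⟯).toRingEquiv.toRingHom)) _

end Literature.NumberTheory.GaloisRepresentations
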